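import Summits.CriticalPhenomena.SAWScalingLimit.Theorems.SAWTotalPositivityTPToTraversalBoundChainPieces

/-!
# Top state of the radial chain (`TopHeaviness`), part I: the trivial regimes

Crux `SAWTotalPositivity.TPToTraversalBound` (stmt-CriticalPhenomena-10687), line `radial-portal-transfer`,
stub `stub_topHeaviness : TopHeaviness` (exponential tail, in the number `m` of big maximal pieces of
the chordal critical SAW outside a clean deep lattice box `B_∞(c, N)` of a FIXED Dobrushin domain,
uniformly over boxes and meshes).

This file closes the HONEST TRIVIAL REGIMES of the statement and reduces it to its scaling content:

* `HasPieces.le_card_box`: a SAW has at most `(2N+1)² + 1` maximal pieces outside the open box of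
  half-side `N` (every piece but the initial one is preceded by a distinct vertex of the open box), so
  for every FIXED `N` the tail in `m` is absorbed by the constant;
* `law_eq_zero_of_not_reachable`, `not_hasPieces_succ_of_self`: unreachable endpoints (law `= 0`)
  and the diagonal `u = v` (no big piece) are vacuous;
* `law_le_one'`, `law_le_ofReal_of_weight_le`: mass `≤ 1`, and the weight (partition-function) form of a
  relative bound gives the `law` form whatever the junk conventions;
* `topHeaviness_of_largeBox`: **reduction** — it suffices to prove the bound for `N ≥ N₀` and `m ≥ m₀`,
  for any thresholds `N₀, m₀` chosen after `(D, a, b)` (small boxes: the event is empty for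
  `m > (2N₀+1)² + 1` and has mass `≤ 1 ≤ C e^{-c₁ m}` otherwise; small counts: mass `≤ 1`).

What is NOT here: the scaling regime itself (`N → ∞` jointly with `δ → 0`), a one-scale statement of
the strength of Kemppainen–Smirnov's Condition G2 / Aizenman–Burchard's (H1) at a fixed aspect ratio
for the critical planar SAW — open in print.
-/

noncomputable section

open MeasureTheory Filter Topology Set Metric
open scoped NNReal ENNReal
open Literature.Probability.LatticeModels
open Literature.Probability.RandomPlanarGeometry
open Literature.Probability.RandomPlanarGeometry.SAW
open Summit.CriticalPhenomena.SAWScalingLimit.Theses.SAWTotalPositivity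

namespace Summit.CriticalPhenomena.SAWScalingLimit.Theorems.TPToTraversalBound.Radial

variable {Ω : Set ℂ} {δ : ℝ} {u v : Site 2}

/-! ## Counting the pieces of one walk -/

/-- In a family of maximal outside pieces listed with increasing starts, every piece but the first
starts at a positive index. [folklore] -/
theorem start_pos_of_strictMono {m : ℕ} {i : Fin (m + 1) → ℕ} (hi : StrictMono i) (k : Fin m) :
    1 ≤ i k.succ := by
  have h : i 0 < i k.succ := hi (Fin.succ_pos k)
  omega

/-- A vertex of the open box of half-side `N` about `c`, re-centred at `c`, lies in the cube
`{-N, …, N}²`. [folklore] -/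
theorem sub_mem_box_of_inOpenBox {c : Site 2} {N : ℕ} {w : Site 2} (h : InOpenBox c N w) :
    w - c ∈ box 2 N := by
  rw [mem_box]
  intro l
  have h1 := abs_sub_le_supDist w c l
  have h2 : supDist w c < N := h
  have h3 := abs_le.1 (h1.trans h2.le)
  simp only [Pi.sub_apply]
  exact ⟨h3.1, h3.2⟩

/-- **At most `(2N+1)² + 1` maximal outside pieces.** If a SAW has `m + 1` maximal pieces outside the
open box `B_∞(c, N)` (of any diameter threshold `d`), then `m ≤ (2N+1)²`: the pieces other than the
initial one are preceded by pairwise distinct vertices of the walk (a path) lying in the open box,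
which has at most `(2N+1)²` sites. Hence for FIXED `N` the heaviness is bounded and every tail bound
in `m` is absorbed by its constant. [folklore] -/
theorem HasPieces.le_card_box {γ : DomainSAW Ω δ u v} {c : Site 2} {N d m : ℕ}
    (h : HasPieces γ c N d (m + 1)) : m ≤ (2 * N + 1) ^ 2 := by
  classical
  obtain ⟨i, j, hi, hk⟩ := h
  have hpos : ∀ k : Fin m, 1 ≤ i k.succ := fun k => start_pos_of_strictMono hi k
  -- the predecessor of the start of a non-initial piece is a box vertex
  have hin : ∀ k : Fin m, InOpenBox c N (γ.walk.getVert (i k.succ - 1)) := fun k =>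
    ((hk k.succ).1.2.2.2.1).resolve_left (by have := hpos k; omega)
  have hle : ∀ k : Fin m, i k.succ - 1 ≤ γ.walk.length := fun k =>
    le_trans (Nat.sub_le _ _) ((hk k.succ).1.1.trans (hk k.succ).1.2.1)
  set f : Fin m → Site 2 := fun k => γ.walk.getVert (i k.succ - 1) - c with hf
  have hmaps : Set.MapsTo f (Finset.univ : Finset (Fin m)) (box 2 N) := fun k _ =>
    sub_mem_box_of_inOpenBox (hin k)
  have hinj : Set.InjOn f (Finset.univ : Finset (Fin m)) := by
    intro k _ k' _ hkk'
    have h1 : γ.walk.getVert (i k.succ - 1) = γ.walk.getVert (i k'.succ - 1) :=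
      sub_left_injective hkk'
    have h2 : i k.succ - 1 = i k'.succ - 1 := γ.isPath.getVert_injOn (hle k) (hle k') h1
    have h3 : i k.succ = i k'.succ := by have := hpos k; have := hpos k'; omega
    exact Fin.succ_injective _ (hi.injective h3)
  have hcard := Finset.card_le_card_of_injOn f hmaps hinj
  simpa [card_box] using hcard

/-- Contrapositive form: no SAW has `(2N+1)² + 2` or more maximal outside pieces, so the heaviness
event is EMPTY there. [folklore] -/
theorem not_hasPieces_of_card_box_lt (γ : DomainSAW Ω δ u v) (c : Site 2) {N d m : ℕ}
    (hm : (2 * N + 1) ^ 2 + 1 < m) : ¬ HasPieces γ c N d m := by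
  intro h
  obtain ⟨m', rfl⟩ : ∃ m', m = m' + 1 := ⟨m - 1, by omega⟩
  have := h.le_card_box
  omega

/-! ## Degenerate endpoint data -/

/-- If the endpoints are not joined in `Ω_δ` there is no SAW at all and the law is the zero measure
(so every bound holds trivially before the eventual reachability of `IsEndpointApprox` kicks in).
[folklore] -/
theorem law_eq_zero_of_not_reachable (h : ¬ (discreteDomainGraph Ω δ).Reachable u v) :
    law Ω δ u v = 0 := by
  haveI : IsEmpty (DomainSAW Ω δ u v) := ⟨fun γ => h ⟨γ.walk⟩⟩
  exact Measure.eq_zero_of_isEmpty _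

/-- On the diagonal `u = v` the only SAW is the trivial one, which has no piece of positive
sup-diameter: the heaviness event with `m ≥ 1`, `d ≥ 1` is empty there. [folklore] -/
-- adapted from Summits/CriticalPhenomena/SAWScalingLimit/Cruxes/TPToTraversalBound/Disproof.lean §10
theorem not_hasPieces_succ_of_self (γ : DomainSAW Ω δ u u) (c : Site 2) {N d m : ℕ} (hd : 1 ≤ d) :
    ¬ HasPieces γ c N d (m + 1) := by
  intro h
  obtain ⟨i, j, -, hk⟩ := h.of_le (show 1 ≤ m + 1 by omega)
  obtain ⟨⟨hij, hjl, -⟩, t, t', h1, h2, h3, h4, h5⟩ := hk 0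
  have hlen : γ.walk.length = 0 :=
    SimpleGraph.Walk.length_eq_zero_iff.2 (SimpleGraph.Walk.isPath_iff_nil.1 γ.isPath)
  have ht : t = t' := by omega
  subst ht
  rw [supDist_self, mul_zero] at h5
  have : (1 : ℤ) ≤ d := by exact_mod_cast hd
  omega

/-! ## Mass at most one; weight form of a relative bound -/

/-- Whatever the junk conventions (`law = 0` if the endpoints are not joined), the SAW law gives mass
at most `1` to every event. [folklore] -/
theorem law_le_one' (S : Set (DomainSAW Ω δ u v)) : law Ω δ u v S ≤ 1 := by
  calc law Ω δ u v S ≤ law Ω δ u v Set.univ := measure_mono (Set.subset_univ _)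
    _ = (weight Ω δ u v Set.univ)⁻¹ * weight Ω δ u v Set.univ := by
        rw [law, Measure.smul_apply, smul_eq_mul]
    _ ≤ 1 := ENNReal.inv_mul_le_one _

/-- **Weight form ⇒ law form.** A bound of an event's critical weight (partition function restricted
to the event) by `p` times the total weight gives the bound `p` for its probability, in all junk
cases as well (`law = 0` when the total weight vanishes or is infinite). [folklore] -/
theorem law_le_ofReal_of_weight_le {S : Set (DomainSAW Ω δ u v)} {p : ℝ}
    (h : weight Ω δ u v S ≤ ENNReal.ofReal p * weight Ω δ u v Set.univ) :
    law Ω δ u v S ≤ ENNReal.ofReal p := by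
  rw [law, Measure.smul_apply, smul_eq_mul]
  calc (weight Ω δ u v Set.univ)⁻¹ * weight Ω δ u v S
      ≤ (weight Ω δ u v Set.univ)⁻¹ * (ENNReal.ofReal p * weight Ω δ u v Set.univ) := by
        gcongr
    _ = ENNReal.ofReal p * ((weight Ω δ u v Set.univ)⁻¹ * weight Ω δ u v Set.univ) := by ring
    _ ≤ ENNReal.ofReal p * 1 := by
        gcongr
        exact ENNReal.inv_mul_le_one _
    _ = ENNReal.ofReal p := mul_one _

/-- The trivial bound `law ≤ 1 ≤ C e^{-c₁ m}` whenever `C e^{-c₁ m} ≥ 1`, in particular for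
`m ≤ B` and `C ≥ e^{c₁ B}`. [folklore] -/
theorem law_le_ofReal_exp_of_le {S : Set (DomainSAW Ω δ u v)} {C c₁ : ℝ} {B m : ℕ}
    (hC : Real.exp (c₁ * B) ≤ C) (hc₁ : 0 ≤ c₁) (hm : m ≤ B) :
    law Ω δ u v S ≤ ENNReal.ofReal (C * Real.exp (-(c₁ * m))) := by
  refine (law_le_one' S).trans (ENNReal.one_le_ofReal.2 ?_)
  have h1 : Real.exp (c₁ * m) ≤ Real.exp (c₁ * B) :=
    Real.exp_le_exp.2 (mul_le_mul_of_nonneg_left (by exact_mod_cast hm) hc₁)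
  have h2 : Real.exp (c₁ * m) * Real.exp (-(c₁ * m)) = 1 := by
    rw [← Real.exp_add, add_neg_cancel, Real.exp_zero]
  calc (1 : ℝ) = Real.exp (c₁ * m) * Real.exp (-(c₁ * m)) := h2.symm
    _ ≤ C * Real.exp (-(c₁ * m)) :=
        mul_le_mul_of_nonneg_right (h1.trans hC) (Real.exp_pos _).le

/-! ## Reduction to large boxes and large counts -/

/-- **Reduction of `TopHeaviness` to its scaling content.** If for every Dobrushin domain and
endpoint approximation the exponential tail of the heaviness of clean deep boxes holds for all boxes
of half-side `N ≥ N₀` and all counts `m ≥ m₀` (thresholds chosen after `(D, a, b)`), then it holds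
for all `N ≥ 1` and all `m`: for `N < N₀` the event is empty as soon as `m > (2N₀+1)² + 1`
(`HasPieces.le_card_box`) and otherwise has mass `≤ 1 ≤ C' e^{-c₁ m}` with
`C' = max C 1 · e^{c₁ B}`, `B = max m₀ ((2N₀+1)² + 1)`; the same constant absorbs `m < m₀`.
[folklore] -/
theorem topHeaviness_of_largeBox :
    (∀ (D : DobrushinDomain) (a b : ℝ → Site 2), IsEndpointApprox D a b →
      ∃ (N₀ m₀ : ℕ) (C c₁ δ₀ : ℝ), 0 < c₁ ∧ 0 < δ₀ ∧ ∀ δ ∈ Set.Ioc (0 : ℝ) δ₀,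
        ∀ (c : Site 2) (N m : ℕ), N₀ ≤ N → m₀ ≤ m →
          Metric.closedBall (meshPoint δ c) (4 * N * δ) ⊆ D.carrier →
            law D.carrier δ (a δ) (b δ) {γ | HasPieces γ c N N m} ≤
              ENNReal.ofReal (C * Real.exp (-(c₁ * m)))) →
    TopHeaviness := by
  intro h D a b hab
  obtain ⟨N₀, m₀, C, c₁, δ₀, hc₁, hδ₀, h⟩ := h D a b hab
  set B : ℕ := max m₀ ((2 * N₀ + 1) ^ 2 + 1) with hB
  set C' : ℝ := max C 1 * Real.exp (c₁ * B) with hC'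
  have hexp1 : 1 ≤ Real.exp (c₁ * B) := Real.one_le_exp (by positivity)
  have hCC' : C ≤ C' := by
    calc C ≤ max C 1 := le_max_left _ _
      _ = max C 1 * 1 := (mul_one _).symm
      _ ≤ max C 1 * Real.exp (c₁ * B) :=
          mul_le_mul_of_nonneg_left hexp1 (le_trans zero_le_one (le_max_right _ _))
  have hC'B : Real.exp (c₁ * B) ≤ C' := by
    calc Real.exp (c₁ * B) = 1 * Real.exp (c₁ * B) := (one_mul _).symm
      _ ≤ max C 1 * Real.exp (c₁ * B) :=
          mul_le_mul_of_nonneg_right (le_max_right _ _) (Real.exp_pos _).le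
  refine ⟨C', c₁, δ₀, hc₁, hδ₀, fun δ hδ c N m hN hball => ?_⟩
  by_cases hm : m ≤ B
  · exact law_le_ofReal_exp_of_le hC'B hc₁.le hm
  push Not at hm
  have hm₀ : m₀ ≤ m := le_trans (le_max_left _ _) hm.le
  by_cases hNN : N₀ ≤ N
  · exact (h δ hδ c N m hNN hm₀ hball).trans
      (ENNReal.ofReal_le_ofReal (mul_le_mul_of_nonneg_right hCC' (Real.exp_pos _).le))
  · -- small box: the event is empty
    push Not at hNN
    have hlt : (2 * N + 1) ^ 2 + 1 < m := by
      have h1 : (2 * N + 1) ^ 2 ≤ (2 * N₀ + 1) ^ 2 :=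
        Nat.pow_le_pow_left (by omega) 2
      have h2 : (2 * N₀ + 1) ^ 2 + 1 ≤ B := le_max_right _ _
      omega
    have hempty : {γ : DomainSAW D.carrier δ (a δ) (b δ) | HasPieces γ c N N m} = ∅ :=
      Set.eq_empty_of_forall_notMem fun γ hγ => not_hasPieces_of_card_box_lt γ c hlt hγ
    rw [hempty, measure_empty]
    exact bot_le

end Summit.CriticalPhenomena.SAWScalingLimit.Theorems.TPToTraversalBound.Radial

end
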